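import Summits.BirchSwinnertonDyer.BirchSwinnertonDyer.Theorems.PrintX9HowardContainmentLightFrameOfPrintOfNonvanishing
import HarnessLib

/-!
# Line `torsion-depth-light-ofprint` on crux `HowardContainmentLightFrameOfPrint` (stmt-BirchSwinnertonDyer-25235),
# RESHAPED CUT v4 — the HONEST ONE-STUB SKELETON (x9-p2 g9, 2026-08-29)

The crux (route PrintX9, rev 18+; banked aside r203) is
`MastellaZermanHowardDivisibility → CGLSHowardDivisibilityLocalized → AnticyclotomicTowerInRingClassFields →
HowardContainmentLightFrame`. Census of record (x9-p1 LEAD g5, evidence #13; x9-p2 g8; ref g7): AS TYPED it is not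
closable by name from its three binders — at `p ∣ h_K` the conclusion `I(ℋ_∞(F))² ⊆ char_Λ(X_tors)` needs ONE Heegner
family `F` with `𝔖 ⧸ ℋ_∞(F)` `Λ`-torsion (off the torsion locus `Module.charIdeal` is the junk value `⊤`), i.e. a
non-torsion `Λ`-adic Heegner class: Cornut–Vatsal through CGLS 2022 Thm. 4.1.1, which the route carries as the
cite-only print leaf `CGLSHeegnerClassNonvanishing` (stmt-BirchSwinnertonDyer-27103) but NOT as a binder of this item.
The repaired statement is LANDED (p681863, `Theorems/PrintX9HowardContainmentLightFrameOfPrintOfNonvanishing.lean`):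
`PrintX9OfPrintNonvanishing.howardContainmentLightFrameOfPrint_of_nonvanishing :
CGLSHeegnerClassNonvanishing → HowardContainmentLightFrameOfPrint` — the v3 SCALING REDUCTION of this line with every
v3 stub a tree theorem (coherent-pair envelope `exists_coherent_pair_envelope`, torsion transfer, CGLS 4.1.3 at corank
one via `X9.thm413Hypotheses_of_lightFrame` / `X9.selmerCorank_eq_one_of_rank_one`, the μ-blind promotion
`PrintX9Rescaling.stub_rescaling`, the sharp tower theorem `anticyclotomicTowerSharp`).

This v4 cut therefore replaces the two remaining v3 stubs — `stub_exists_stabilized_heegnerModule_le_smul` (superseded: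
the envelope engine proves the coherent-pair form it asked for) and `stub_heegnerModule_quotient_isTorsion` (misstated
as registered: it lacks the same binder) — by the ONE stub the kernel proof actually consumes, whose letter IS the
print leaf 27103 BY NAME. Reading of the registry after this check: «25235 closes modulo exactly
`CGLSHeegnerClassNonvanishing`» (a cite-only WHOLE-VALUE print item, never seat work). No new mathematics; no
μ-invariant statement; `hMZ` and the unsharp `hTw` are unused by the closer. Composition `HowardContainmentLightFrameOfPrint_of`
concludes the crux BY NAME; `sorry` only inside `stub_*`. No summit statement is proved; BSD is NOT proved by any of this.
-/

set_option linter.dupNamespace false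
set_option autoImplicit false

namespace Summit.BirchSwinnertonDyer.BirchSwinnertonDyer.Cruxes.HowardContainmentLightFrameOfPrint.TorsionDepthLight

/-! ## Stub statement as a named proposition -/

/-- **The one stub of cut v4: CGLS 2022 Thm. 4.1.1 + Rem. 4.1.4 + §3.3 torsion-freeness BY NAME** — the route's
cite-only print leaf `CGLSHeegnerClassNonvanishing` (stmt-BirchSwinnertonDyer-27103) VERBATIM: under
`Thm413Hypotheses`, for every `Λ`-adic Selmer datum `D` and stabilised Heegner datum `C`, `𝔖 = D.S` is torsion-free,
`Λκ_∞(C) ≠ ⊥` (Cornut–Vatsal) and `𝔖 ⧸ Λκ_∞(C)` is `Λ`-torsion. It is the binder the rev-18 typing of the crux lacks;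
it closes only when the leaf becomes a kernel theorem.
[cite: CastellaGrossiLeeSkinner2022, Thm. 4.1.1, Rem. 4.1.4 (arXiv:2008.02571 §4.1)] [cite: CornutVatsal2007, Thm. 1.5] -/
def Stmt.stub_cglsHeegnerClassNonvanishing : Prop :=
  Summit.BirchSwinnertonDyer.BirchSwinnertonDyer.Theses.PrintX9.CGLSHeegnerClassNonvanishing

/-! ## The stub (the ONLY sorry of the file) -/

/-- Stub: the print leaf `CGLSHeegnerClassNonvanishing` (stmt-BirchSwinnertonDyer-27103), cite-only. -/
theorem stub_cglsHeegnerClassNonvanishing : Stmt.stub_cglsHeegnerClassNonvanishing := by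
  sorry

/-! ## Composition (kernel-checked, no `sorry`) -/

/-- **The crux BY NAME from the one stub**: the landed repaired closer
`PrintX9OfPrintNonvanishing.howardContainmentLightFrameOfPrint_of_nonvanishing` (p681863) applied to the stub letter
(which unfolds to the leaf `CGLSHeegnerClassNonvanishing` by `rfl`). -/
theorem HowardContainmentLightFrameOfPrint_of (h : Stmt.stub_cglsHeegnerClassNonvanishing) :
    Summit.BirchSwinnertonDyer.BirchSwinnertonDyer.Theses.PrintX9.HowardContainmentLightFrameOfPrint := by
  unfold Stmt.stub_cglsHeegnerClassNonvanishing at h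
  exact Summit.BirchSwinnertonDyer.BirchSwinnertonDyer.Theorems.PrintX9OfPrintNonvanishing.howardContainmentLightFrameOfPrint_of_nonvanishing h

/-- The composed line from the stub (sorries only through `stub_*`). -/
theorem HowardContainmentLightFrameOfPrint_of_stubs :
    Summit.BirchSwinnertonDyer.BirchSwinnertonDyer.Theses.PrintX9.HowardContainmentLightFrameOfPrint :=
  HowardContainmentLightFrameOfPrint_of stub_cglsHeegnerClassNonvanishing

end Summit.BirchSwinnertonDyer.BirchSwinnertonDyer.Cruxes.HowardContainmentLightFrameOfPrint.TorsionDepthLight
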